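import Mathlib

/-!
# Negative lemmas for crux `OverlapGapAlgebra.NoStableSection` (stmt-PneNP-2462)

Refuter (cdisprove) output, supports stmt-PneNP-2462; no statement of the route is asserted
positively (Mathlib-only imports: every variant below is spelled out verbatim from the route decl's
text, and `NoStableSection ↔ ∃ k₀, ∀ k ≥ k₀, NoStableSectionAt k` is `Iff.rfl` in any file that
imports the route). Three kernel-checked facts about the SHAPE of the crux (Bresler–Huang's ensemble
multi-OGP for random k-SAT read for arbitrary sections, arXiv:2106.02129 Thm 2.6 / Props 4.6–4.7):

* `noStableSectionAt_zero_false`, `noStableSectionAt_one_false`, `not_forall_noStableSectionAt` —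
  the threshold `k₀` is necessary: at widths `k = 0, 1` the density `5·2^k·log k/k` vanishes
  (`Real.log 0 = Real.log 1 = 0`), `m = 0`, the path space is one point, every section is valid and
  stable on it, and `1 ≤ e^{-cn}` fails; so the crux's body `NoStableSectionAt k` is FALSE at
  `k ≤ 1` and the strengthening "for every width" is false.
* `noStableSection_false_without_valid` — ν-VALIDITY IS LOAD-BEARING: with the validity conjunct
  deleted, the constant section `g ≡ true` (movement `0`) makes the event the whole path space.
* `not_noStableSectionForallRate` — THE EXPONENTIAL SCALE IS TIGHT: replacing `∃ c > 0` by
  `∀ c > 0` is false; for `k ≥ 1` the all-positive paths (fraction `2^{-k·m·(k+1)}`) carry the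
  constant-`true` section validly (no clause with a positive literal is violated by `true`) and
  stably, so the event has probability `≥ e^{-(k(k+1)·α_k·log 2)·n}`, `α_k = 5·2^k·log k/k`; any
  admissible rate satisfies `c ≤ k(k+1)·α_k·log 2` (in particular `c` must depend on `k`).
-/

namespace Summit.PneNP.PneNP.Cruxes.NoStableSection.Negative

set_option linter.dupNamespace false

open Finset Real Filter

/-- The crux's body at a FIXED clause width `k`: verbatim the text of the route decl
`Summit.PneNP.PneNP.Theses.OverlapGapAlgebra.NoStableSection` after its leading `∃ k₀ : ℕ, ∀ k ≥ k₀,`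
(so `NoStableSection ↔ ∃ k₀, ∀ k ≥ k₀, NoStableSectionAt k` holds by `Iff.rfl`; this file is kept
free of the route import so that it elaborates against Mathlib alone). -/
def NoStableSectionAt (k : ℕ) : Prop :=
  ∃ η : ℝ, 0 < η ∧ ∃ ν : ℝ, 0 < ν ∧ ∃ c : ℝ, 0 < c ∧ ∀ᶠ n : ℕ in Filter.atTop, ∀ m : ℕ, m = ⌊5 * 2 ^ k * Real.log k / k * n⌋₊ → ∀ g : (Fin m → Fin k → Fin n × Bool) → (Fin n → Bool), ((Finset.univ.filter fun Ψ : Fin (k + 1) → Fin m → Fin k → Fin n × Bool => let P : Fin k → ℕ → Fin m → Fin k → Fin n × Bool := fun r q a b => if (a : ℕ) * k + b < q then Ψ r.succ a b else Ψ r.castSucc a b; (∀ r : Fin k, ∀ q ≤ m * k, ((Finset.univ.filter fun i : Fin m => ∀ j, g (P r q) (P r q i j).1 ≠ (P r q i j).2).card : ℝ) ≤ ν * m) ∧ ∀ r : Fin k, ∀ q < m * k, (hammingDist (g (P r q)) (g (P r (q + 1))) : ℝ) ≤ η * n).card : ℝ) ≤ Real.exp (-(c * n)) * Fintype.card (Fin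 (k + 1) → Fin m → Fin k → Fin n × Bool)

/-- Degenerate widths: at `k = 1` the density `5·2^k·log k/k` is `0` (`Real.log 1 = 0`), so `m = 0`,
the path space is a single point on which every `g` is trivially valid and stable, and the claimed
bound `1 ≤ e^{-cn}` fails. Hence `k₀ ≥ 2` is necessary (the strengthening `∀ k ≥ 1` is FALSE). -/
theorem noStableSectionAt_one_false : ¬ NoStableSectionAt 1 := by
  rintro ⟨η, hη, ν, hν, c, hc, hev⟩
  obtain ⟨N, hN⟩ := Filter.eventually_atTop.1 hev
  have hm : (0 : ℕ) = ⌊5 * 2 ^ (1 : ℕ) * Real.log ((1 : ℕ) : ℝ) / ((1 : ℕ) : ℝ) * ((max N 1 : ℕ) : ℝ)⌋₊ := by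
    simp
  have h := hN (max N 1) (le_max_left _ _) 0 hm (fun _ _ => true)
  simp at h
  exact absurd h (not_le.2 (mul_pos hc (lt_max_of_lt_right one_pos)))

/-- Same at `k = 0` (`Real.log 0 = 0`, `m = 0`). -/
theorem noStableSectionAt_zero_false : ¬ NoStableSectionAt 0 := by
  rintro ⟨η, hη, ν, hν, c, hc, hev⟩
  obtain ⟨N, hN⟩ := Filter.eventually_atTop.1 hev
  have hm : (0 : ℕ) = ⌊5 * 2 ^ (0 : ℕ) * Real.log ((0 : ℕ) : ℝ) / ((0 : ℕ) : ℝ) * ((max N 1 : ℕ) : ℝ)⌋₊ := by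
    simp
  have h := hN (max N 1) (le_max_left _ _) 0 hm (fun _ _ => true)
  simp at h
  exact absurd h (not_le.2 (mul_pos hc (lt_max_of_lt_right one_pos)))

/-- The natural strengthening "for every clause width" (`k₀ = 0`) of the crux is FALSE. -/
theorem not_forall_noStableSectionAt : ¬ ∀ k : ℕ, NoStableSectionAt k :=
  fun h => noStableSectionAt_one_false (h 1)

/-! ## (a) Load-bearing hypotheses

### Validity is load-bearing: `NoStableSection` with the ν-validity conjunct DROPPED is false
(the constant section `g ≡ (fun _ => true)` never moves, so EVERY path is "stable"). -/

/-- The crux with the validity conjunct `∀ r, ∀ q ≤ m k, #violated ≤ ν m` deleted (only the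
`η n`-stability of consecutive outputs is kept). -/
def NoStableSectionWithoutValid : Prop :=
  ∃ k₀ : ℕ, ∀ k ≥ k₀, ∃ η : ℝ, 0 < η ∧ ∃ c : ℝ, 0 < c ∧ ∀ᶠ n : ℕ in Filter.atTop, ∀ m : ℕ,
    m = ⌊5 * 2 ^ k * Real.log k / k * n⌋₊ →
    ∀ g : (Fin m → Fin k → Fin n × Bool) → (Fin n → Bool),
      ((Finset.univ.filter fun Ψ : Fin (k + 1) → Fin m → Fin k → Fin n × Bool =>
        let P : Fin k → ℕ → Fin m → Fin k → Fin n × Bool := fun r q a b =>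
          if (a : ℕ) * k + b < q then Ψ r.succ a b else Ψ r.castSucc a b
        ∀ r : Fin k, ∀ q < m * k, (hammingDist (g (P r q)) (g (P r (q + 1))) : ℝ) ≤ η * n).card : ℝ)
      ≤ Real.exp (-(c * n)) * Fintype.card (Fin (k + 1) → Fin m → Fin k → Fin n × Bool)

/-- **Any proof of the crux must use ν-validity**: without it the constant section is a
counterexample at every `k` (witness `g := fun _ _ => true`, Hamming movement `0 ≤ η n`; the event is
the whole path space, of positive cardinality, while `e^{-cn} < 1`). -/
theorem noStableSection_false_without_valid : ¬ NoStableSectionWithoutValid := by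
  rintro ⟨k₀, h⟩
  obtain ⟨η, hη, c, hc, hev⟩ := h k₀ le_rfl
  obtain ⟨N, hN⟩ := Filter.eventually_atTop.1 hev
  set n : ℕ := max N 1 with hn
  have hn1 : 1 ≤ n := le_max_right _ _
  have h := hN n (le_max_left _ _) _ rfl (fun _ _ => true)
  have hηn : (0 : ℝ) ≤ η * n := by positivity
  simp only [hammingDist_self, Nat.cast_zero, hηn, implies_true, Finset.filter_true,
    Finset.card_univ] at h
  haveI : Nonempty (Fin n) := ⟨⟨0, hn1⟩⟩
  have hpos : (0 : ℝ) < Fintype.card (Fin (k₀ + 1) → Fin ⌊5 * 2 ^ k₀ * Real.log k₀ / k₀ * n⌋₊ →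
      Fin k₀ → Fin n × Bool) := by exact_mod_cast Fintype.card_pos
  have hexp : Real.exp (-(c * n)) < 1 := by
    rw [Real.exp_lt_one_iff]
    have : (1 : ℝ) ≤ n := by exact_mod_cast hn1
    nlinarith
  nlinarith

/-! ## (b) Tightness of the exponential scale

The bound `e^{-cn}` cannot be improved to a super-exponential one: the crux with `∃ c > 0` replaced
by `∀ c > 0` is FALSE. Witness: the constant section `g ≡ true` together with the ALL-POSITIVE
paths `Ψ s a b = (v, true)` (a `2^{-(k+1)·m·k}` fraction of the path space): every instance on such
a path has only positive literals, so `g` violates no clause and never moves. Hence for every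
`k ≥ 1` the event has probability `≥ 2^{-(k+1)mk} ≥ e^{-(k(k+1)·α_k·log 2)·n}`, `α_k = 5·2^k log k/k`:
the rate `c` of the crux is at most `k(k+1) α_k log 2` (it must depend on `k`). -/

/-- The crux with `∃ c > 0, ∀ᶠ n, …` strengthened to `∀ c > 0, ∀ᶠ n, …` (super-exponential decay). -/
def NoStableSectionForallRate : Prop :=
  ∃ k₀ : ℕ, ∀ k ≥ k₀, ∃ η : ℝ, 0 < η ∧ ∃ ν : ℝ, 0 < ν ∧ ∀ c : ℝ, 0 < c → ∀ᶠ n : ℕ in Filter.atTop, ∀ m : ℕ, m = ⌊5 * 2 ^ k * Real.log k / k * n⌋₊ → ∀ g : (Fin m → Fin k → Fin n × Bool) → (Fin n → Bool), ((Finset.univ.filter fun Ψ : Fin (k + 1) → Fin m → Fin k → Fin n × Bool => let P : Fin k → ℕ → Fin m → Fin k → Fin n × Bool := fun r q a b => if (a : ℕ) * k + b < q then Ψ r.succ a b else Ψ r.castSucc a b; (∀ r : Fin k, ∀ q ≤ m * k, ((Finset.univ.filter fun i : Fin m => ∀ j, g (P r q) (P r q i j).1 ≠ (P r q i j).2).card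 : ℝ) ≤ ν * m) ∧ ∀ r : Fin k, ∀ q < m * k, (hammingDist (g (P r q)) (g (P r (q + 1))) : ℝ) ≤ η * n).card : ℝ) ≤ Real.exp (-(c * n)) * Fintype.card (Fin (k + 1) → Fin m → Fin k → Fin n × Bool)

/-- **Tightness of the scale**: the super-exponential strengthening `NoStableSectionForallRate` is false. For
`k ≥ 1` and ANY `η, ν ≥ 0`, the all-positive paths (an injective image of
`Fin (k+1) → Fin m → Fin k → Fin n`) lie in the event of the constant-`true` section, so
`#event ≥ #paths / 2^{k·m·(k+1)}`, contradicting `#event ≤ e^{-cn} #paths` at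
`c := k(k+1)·α_k + 1 > k(k+1)·(m/n)·log 2`. -/
theorem not_noStableSectionForallRate : ¬ NoStableSectionForallRate := by
  rintro ⟨k₀, h⟩
  -- work at a width `k ≥ 1`
  set k : ℕ := max k₀ 1 with hkdef
  have hk1 : 1 ≤ k := le_max_right _ _
  obtain ⟨η, hη, ν, hν, hall⟩ := h k (le_max_left _ _)
  set α : ℝ := 5 * 2 ^ k * Real.log k / k with hα
  have hlog : 0 ≤ Real.log k := Real.log_nonneg (by exact_mod_cast hk1)
  have hα0 : 0 ≤ α := by rw [hα]; positivity
  set c : ℝ := α * (k * (k + 1)) + 1 with hc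
  have hc0 : 0 < c := by rw [hc]; positivity
  obtain ⟨N, hN⟩ := Filter.eventually_atTop.1 (hall c hc0)
  set n : ℕ := max N 1 with hn
  have hn1 : 1 ≤ n := le_max_right _ _
  set m : ℕ := ⌊α * n⌋₊ with hm
  have hmle : (m : ℝ) ≤ α * n := Nat.floor_le (by positivity)
  have hmain := hN n (le_max_left _ _) m (by rw [hm, hα]) (fun _ _ => true)
  -- the all-positive paths are in the event
  let e : (Fin (k + 1) → Fin m → Fin k → Fin n) → (Fin (k + 1) → Fin m → Fin k → Fin n × Bool) :=
    fun F s a b => (F s a b, true)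
  have he : Function.Injective e := by
    intro F G hFG
    funext s a b
    have := congrFun (congrFun (congrFun hFG s) a) b
    simpa [e] using this
  haveI : Nonempty (Fin k) := ⟨⟨0, hk1⟩⟩
  have hνm : (0 : ℝ) ≤ ν * m := by positivity
  have hηn : (0 : ℝ) ≤ η * n := by positivity
  have hsub : Finset.univ.image e ⊆ Finset.univ.filter fun Ψ : Fin (k + 1) → Fin m → Fin k → Fin n × Bool =>
      let P : Fin k → ℕ → Fin m → Fin k → Fin n × Bool := fun r q a b =>
        if (a : ℕ) * k + b < q then Ψ r.succ a b else Ψ r.castSucc a b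
      (∀ r : Fin k, ∀ q ≤ m * k, ((Finset.univ.filter fun i : Fin m => ∀ j,
        (fun (_ : Fin m → Fin k → Fin n × Bool) (_ : Fin n) => true) (P r q) (P r q i j).1 ≠
          (P r q i j).2).card : ℝ) ≤ ν * m) ∧
      ∀ r : Fin k, ∀ q < m * k, (hammingDist ((fun (_ : Fin m → Fin k → Fin n × Bool) (_ : Fin n) => true) (P r q))
        ((fun (_ : Fin m → Fin k → Fin n × Bool) (_ : Fin n) => true) (P r (q + 1))) : ℝ) ≤ η * n := by
    intro Ψ hΨ
    rw [Finset.mem_image] at hΨ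
    obtain ⟨F, -, rfl⟩ := hΨ
    rw [Finset.mem_filter]
    refine ⟨Finset.mem_univ _, ?_, ?_⟩
    · intro r q hq
      refine le_trans ?_ hνm
      have hz : ∀ s : Finset (Fin m), s = ∅ → ((s.card : ℕ) : ℝ) ≤ 0 := fun s hs => by simp [hs]
      apply hz
      rw [Finset.filter_eq_empty_iff]
      intro i _ hall'
      have := hall' ⟨0, hk1⟩
      apply this
      beta_reduce
      split <;> rfl
    · intro r q hq
      simp only [hammingDist_self, Nat.cast_zero]
      exact hηn
  have hcard_le : (Fintype.card (Fin (k + 1) → Fin m → Fin k → Fin n) : ℝ) ≤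
      ((Finset.univ.filter fun Ψ : Fin (k + 1) → Fin m → Fin k → Fin n × Bool =>
      let P : Fin k → ℕ → Fin m → Fin k → Fin n × Bool := fun r q a b =>
        if (a : ℕ) * k + b < q then Ψ r.succ a b else Ψ r.castSucc a b
      (∀ r : Fin k, ∀ q ≤ m * k, ((Finset.univ.filter fun i : Fin m => ∀ j,
        (fun (_ : Fin m → Fin k → Fin n × Bool) (_ : Fin n) => true) (P r q) (P r q i j).1 ≠
          (P r q i j).2).card : ℝ) ≤ ν * m) ∧
      ∀ r : Fin k, ∀ q < m * k, (hammingDist ((fun (_ : Fin m → Fin k → Fin n × Bool) (_ : Fin n) => true) (P r q))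
        ((fun (_ : Fin m → Fin k → Fin n × Bool) (_ : Fin n) => true) (P r (q + 1))) : ℝ) ≤ η * n).card : ℝ) := by
    have := Finset.card_le_card hsub
    rw [Finset.card_image_of_injective _ he, Finset.card_univ] at this
    exact_mod_cast this
  -- cardinalities of the two path spaces
  have hA : (Fintype.card (Fin (k + 1) → Fin m → Fin k → Fin n) : ℝ) = (((n : ℝ) ^ k) ^ m) ^ (k + 1) := by
    simp only [Fintype.card_fun, Fintype.card_fin]
    push_cast
    ring
  have hB : (Fintype.card (Fin (k + 1) → Fin m → Fin k → Fin n × Bool) : ℝ) =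
      (((n : ℝ) ^ k) ^ m) ^ (k + 1) * (2 : ℝ) ^ (k * m * (k + 1)) := by
    simp only [Fintype.card_fun, Fintype.card_fin, Fintype.card_prod, Fintype.card_bool]
    push_cast
    ring
  set A : ℝ := (((n : ℝ) ^ k) ^ m) ^ (k + 1) with hAdef
  have hApos : 0 < A := by positivity
  -- combine: A ≤ #event ≤ e^{-cn} · A · 2^{k m (k+1)}
  have h1 : A ≤ Real.exp (-(c * n)) * (A * (2 : ℝ) ^ (k * m * (k + 1))) := by
    rw [hA] at hcard_le
    rw [hB] at hmain
    exact hcard_le.trans hmain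
  have h2 : (1 : ℝ) ≤ Real.exp (-(c * n)) * (2 : ℝ) ^ (k * m * (k + 1)) := by
    by_contra hlt
    rw [not_le] at hlt
    have : Real.exp (-(c * n)) * (A * (2 : ℝ) ^ (k * m * (k + 1))) < A := by
      calc Real.exp (-(c * n)) * (A * (2 : ℝ) ^ (k * m * (k + 1)))
          = (Real.exp (-(c * n)) * (2 : ℝ) ^ (k * m * (k + 1))) * A := by ring
        _ < 1 * A := mul_lt_mul_of_pos_right hlt hApos
        _ = A := one_mul A
    linarith
  have h3 := Real.log_le_log one_pos h2
  rw [Real.log_one, Real.log_mul (Real.exp_pos _).ne' (by positivity), Real.log_exp,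
    Real.log_pow] at h3
  -- h3 : 0 ≤ -(c n) + (k m (k+1)) log 2
  have hlog2 : Real.log 2 ≤ 1 := by
    have := Real.log_le_sub_one_of_pos (by norm_num : (0 : ℝ) < 2)
    linarith
  have hkm : ((k * m * (k + 1) : ℕ) : ℝ) * Real.log 2 ≤ (k : ℝ) * (k + 1) * (α * n) := by
    have h' : ((k * m * (k + 1) : ℕ) : ℝ) = (k : ℝ) * (k + 1) * m := by push_cast; ring
    rw [h']
    have hkk : (0 : ℝ) ≤ (k : ℝ) * (k + 1) := by positivity
    calc (k : ℝ) * (k + 1) * m * Real.log 2 ≤ (k : ℝ) * (k + 1) * m * 1 :=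
          mul_le_mul_of_nonneg_left hlog2 (by positivity)
      _ = (k : ℝ) * (k + 1) * m := mul_one _
      _ ≤ (k : ℝ) * (k + 1) * (α * n) := mul_le_mul_of_nonneg_left hmle hkk
  have hn1' : (1 : ℝ) ≤ n := by exact_mod_cast hn1
  have hcn : c * n = α * (k * (k + 1)) * n + n := by rw [hc]; ring
  nlinarith

end Summit.PneNP.PneNP.Cruxes.NoStableSection.Negative
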